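import Literature.RingTheory.CohomologyAnnihilator.Basic
import Literature.AlgebraicGeometry.Resolution.RegularLocalRingsProofs
import HarnessLib

/-!
# The cohomology annihilator of a regular / of a local ring

Topic: `Literature/RingTheory/CohomologyAnnihilator`.

For a noetherian LOCAL ring `R` we prove `ca(R) = R ↔ R` is a regular local ring, combining
[IyengarTakahashi2014, Example 2.5] ("`gldim R ≤ d` iff `caᵈ⁺¹(R) = R`", landed as
`cohomologyAnnihilatorOfDegree_eq_top_iff_hasProjectiveDimensionLT`) with Serre's theorem
(Auslander–Buchsbaum–Serre) in the form landed in
`Literature.AlgebraicGeometry.Resolution.RegularLocalRingsProofs` [Matsumura1987, Thm. 19.2]: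

* regular of dimension `d` ⇒ every finite module has projective dimension `≤ d`
  (`hasProjectiveDimensionLE_length_of_isWeaklyRegular` with a regular system of parameters,
  `exists_isRegular_ofList_eq_maximalIdeal`) ⇒ `caᵈ⁺¹(R) = R`
  (`cohomologyAnnihilatorOfDegree_eq_top_of_isRegularLocalRing`; the "ca of a regular ring is `⊤`"
  sanity target of route `ResolutionOfSingularities/HomologicalConductor`);
* `caⁿ(R) = R` ⇒ `proj dim 𝔪 < ∞` ⇒ `R` regular
  (`IsRegularLocalRing.of_maximalIdeal_hasProjectiveDimensionLE`), whence
  `cohomologyAnnihilator_eq_top_iff_isRegularLocalRing`.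

This is the local ingredient of [IyengarTakahashi2014, Lemma 2.10(2)] (`Sing R ⊆ V(ca R)`), whose
other ingredient is the localisation Lemma 2.10(1) (`Localization.lean`).
-/

noncomputable section

open CategoryTheory CategoryTheory.Abelian IsLocalRing

universe u

namespace Literature.RingTheory.CohomologyAnnihilator

open Literature.AlgebraicGeometry.Resolution

variable (R : Type u) [CommRing R]

/-- A regular local ring of dimension `d` has `caᵈ⁺¹(R) = R`: every finite module has projective
dimension `≤ d` (Serre, [Matsumura1987, Thm. 19.2 (I)]), so `Ext^{≥ d+1}(mod R, mod R) = 0`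
([IyengarTakahashi2014, Example 2.5]). [cite: IyengarTakahashi2014, Example 2.5] -/
theorem cohomologyAnnihilatorOfDegree_eq_top_of_isRegularLocalRing [IsRegularLocalRing R] {d : ℕ}
    (hd : ringKrullDim R = d) : cohomologyAnnihilatorOfDegree R (d + 1) = ⊤ := by
  obtain ⟨rs, reg, span, hlen⟩ := exists_isRegular_ofList_eq_maximalIdeal R
  have hlen' : rs.length = d := by
    rw [hd] at hlen
    exact_mod_cast hlen
  refine cohomologyAnnihilatorOfDegree_eq_top_of_hasProjectiveDimensionLT fun M hM => ?_
  have h := hasProjectiveDimensionLE_length_of_isWeaklyRegular (R := R) reg.toIsWeaklyRegular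
    span M
  rwa [hlen'] at h

/-- A regular local ring has `ca(R) = R` ("the cohomology annihilator of a regular ring is the
unit ideal"). [cite: IyengarTakahashi2014, Example 2.5] -/
theorem cohomologyAnnihilator_eq_top_of_isRegularLocalRing [IsRegularLocalRing R] :
    cohomologyAnnihilator R = ⊤ := by
  obtain ⟨rs, -, -, hlen⟩ := exists_isRegular_ofList_eq_maximalIdeal R
  exact cohomologyAnnihilator_eq_top_iff.mpr
    ⟨rs.length + 1, cohomologyAnnihilatorOfDegree_eq_top_of_isRegularLocalRing R hlen.symm⟩

variable {R} in
/-- A noetherian local ring with `caⁿ(R) = R` for some `n` is regular: `caⁿ(R) = R` gives every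
finite module — in particular `𝔪` — projective dimension `< n` ([IyengarTakahashi2014, Example
2.5]), and a noetherian local ring whose maximal ideal has finite projective dimension is regular
(Serre, [Matsumura1987, Thm. 19.2]). [cite: IyengarTakahashi2014, Lemma 2.10(2) (proof)] -/
theorem isRegularLocalRing_of_cohomologyAnnihilatorOfDegree_eq_top [IsLocalRing R]
    [IsNoetherianRing R] {n : ℕ} (h : cohomologyAnnihilatorOfDegree R n = ⊤) :
    IsRegularLocalRing R := by
  have hfin : Module.Finite R (Shrink.{u} (maximalIdeal R)) :=
    Module.Finite.equiv (Shrink.linearEquiv R (maximalIdeal R)).symm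
  have hlt := hasProjectiveDimensionLT_of_cohomologyAnnihilatorOfDegree_eq_top h
    (ModuleCat.of R (Shrink.{u} (maximalIdeal R)))
  have hle : HasProjectiveDimensionLE (ModuleCat.of R (Shrink.{u} (maximalIdeal R))) n :=
    hasProjectiveDimensionLT_of_ge _ n (n + 1) (Nat.le_succ n)
  exact IsRegularLocalRing.of_maximalIdeal_hasProjectiveDimensionLE ⟨n, hle⟩

variable {R} in
/-- A noetherian local ring with `ca(R) = R` is regular. [cite: IyengarTakahashi2014, Lemma 2.10(2) (proof)] -/
theorem isRegularLocalRing_of_cohomologyAnnihilator_eq_top [IsLocalRing R] [IsNoetherianRing R]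
    (h : cohomologyAnnihilator R = ⊤) : IsRegularLocalRing R := by
  obtain ⟨n, hn⟩ := cohomologyAnnihilator_eq_top_iff.mp h
  exact isRegularLocalRing_of_cohomologyAnnihilatorOfDegree_eq_top hn

/-- For a noetherian local ring: `ca(R) = R ↔ R` is regular (Example 2.5 + Auslander–Buchsbaum–Serre).
[cite: IyengarTakahashi2014, Example 2.5] -/
theorem cohomologyAnnihilator_eq_top_iff_isRegularLocalRing [IsLocalRing R] [IsNoetherianRing R] :
    cohomologyAnnihilator R = ⊤ ↔ IsRegularLocalRing R :=
  ⟨isRegularLocalRing_of_cohomologyAnnihilator_eq_top,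
    fun _ => cohomologyAnnihilator_eq_top_of_isRegularLocalRing R⟩

/-- Contrapositive, membership form: over a SINGULAR (non-regular) noetherian local ring, `ca(R)`
is a proper ideal, i.e. `ca(R) ⊆ 𝔪`. [cite: IyengarTakahashi2014, Lemma 2.10(2)] -/
theorem cohomologyAnnihilator_le_maximalIdeal_of_not_isRegularLocalRing [IsLocalRing R]
    [IsNoetherianRing R] (h : ¬ IsRegularLocalRing R) :
    cohomologyAnnihilator R ≤ maximalIdeal R :=
  IsLocalRing.le_maximalIdeal fun htop => h (isRegularLocalRing_of_cohomologyAnnihilator_eq_top htop)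

end Literature.RingTheory.CohomologyAnnihilator
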